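import Mathlib
import Literature.Analysis.InnerProduct.CourantFischerBounds

/-!
# Venture YMGap, track Y3 FLOW-DATA — the MULTIPLICATIVE GRAM CERTIFICATE of lineage G (flow-eng-4), typed

HONEST FRAMING: venture file of the cell `pub-ymgap` (QuantumFields programme), track Y3.  Lineage G (flow-eng-4,
engine «gstm») builds the kept-set compression of the SU(2) Wilson transfer matrix in GRAM FORM,
`W_S = Xᵀ X` with `X = F · K^{1/2}` (`F` = the product of the half-`β` plaquette factors, `K` = the diagonal link
kernel), holds a floating-point factor `X̃` with a rigorous column-wise error budget, and certifies eigenvalues of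
`W_S` from the computed Gram `X̃ᵀ X̃` by the following lemma (the cell's `multcert/LEMMA.md`, 2026-08-23):

  if `‖(X̃ − X) y‖ ≤ η ‖X̃ y‖` for every `y` (the engine shows this with `η = e/s`, `e ≥ ‖(X̃ − X)K^{-1/2}‖`,
  `s ≤ σ_min(X̃ K^{-1/2})` certified from the data; a priori `s` is bounded below by positivity of the plaquette
  weight), then for EVERY index `k` of the antitone enumeration
  `(1 − η)² λ↓_k(X̃ᵀX̃) ≤ λ↓_k(XᵀX) ≤ (1 + η)² λ↓_k(X̃ᵀX̃)`.

This file is that lemma as pure finite-dimensional linear algebra over `ℝ` (§2), obtained from a general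
MULTIPLICATIVE form-comparison principle for symmetric operators (§1): if `c · re ⟪T x, x⟫ ≤ re ⟪S x, x⟫` for all `x`
(`0 ≤ c`) then `c · λ_k(T) ≤ λ_k(S)` for every `k`, and if `re ⟪S x, x⟫ ≤ c · re ⟪T x, x⟫` for all `x` then
`λ_k(S) ≤ c · λ_k(T)` — both immediate from the two trial-subspace halves of the Courant–Fischer theorem in the tree
(`Literature.Analysis.InnerProduct.CourantFischerBounds`, Horn–Johnson Thm. 4.2.6; the monotonicity of the
sorted eigenvalues in the Loewner order is Horn–Johnson Cor. 4.3.12).  Finite real matrices only; no lattice object,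
no number, no row, nothing about limits or a mass gap.  The floating-point side of a row (how the engine obtains
`η`, and the index-wise enclosure of `λ↓_k(X̃ᵀX̃)` by exact rational inertia) is NOT covered here.

References: R. A. Horn, C. R. Johnson, *Matrix Analysis*, 2nd ed. (2013), Thm. 4.2.6, Cor. 4.3.12, Thm. 7.7.3
[cite: HornJohnson2013, Thm 4.2.6; Cor 4.3.12]; the cell's HOME/pub-ymgap-flow-eng-4/multcert/LEMMA.md (2026-08-23).
-/

noncomputable section

open scoped InnerProductSpace
open Module Matrix

namespace Summit.Ventures.YMGap.FlowData

namespace MultiplicativeGram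

/-! ### §1  Multiplicative comparison of sorted eigenvalues from a comparison of quadratic forms -/

section Forms

variable {𝕜 : Type*} [RCLike 𝕜] {E : Type*} [NormedAddCommGroup E] [InnerProductSpace 𝕜 E]
  [FiniteDimensional 𝕜 E] {T S : E →ₗ[𝕜] E} {n : ℕ}

/-- **Loewner-type monotonicity, multiplicative lower form.** If `c · re ⟪T x, x⟫ ≤ re ⟪S x, x⟫` for every `x`
with `0 ≤ c`, then `c · λ_k(T) ≤ λ_k(S)` for every `k` (test `S` on the span of the top `k + 1` eigenvectors of `T`,
where `λ_k(T) ‖x‖² ≤ re ⟪T x, x⟫`). [cite: HornJohnson2013, Thm 4.2.6; Cor 4.3.12] -/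
theorem mul_eigenvalues_le_of_mul_re_inner_le (hT : T.IsSymmetric) (hS : S.IsSymmetric)
    (hn : finrank 𝕜 E = n) {c : ℝ} (hc0 : 0 ≤ c)
    (hc : ∀ x : E, c * RCLike.re ⟪T x, x⟫_𝕜 ≤ RCLike.re ⟪S x, x⟫_𝕜) (k : Fin n) :
    c * hT.eigenvalues hn k ≤ hS.eigenvalues hn k := by
  obtain ⟨x, hxW, hx0, hle⟩ := Literature.Analysis.InnerProduct.exists_mem_re_inner_le_eigenvalues_mul hS hn k
    (Submodule.span 𝕜 (Set.range fun j : {j : Fin n // j ≤ k} => hT.eigenvectorBasis hn j)) (by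
    rw [Literature.Analysis.InnerProduct.finrank_headSpan hT hn k])
  have hT' : hT.eigenvalues hn k * ‖x‖ ^ 2 ≤ RCLike.re ⟪T x, x⟫_𝕜 :=
    Literature.Analysis.InnerProduct.le_re_inner_apply_self_of_inner_eq_zero hT hn k
      (fun i hi => Literature.Analysis.InnerProduct.inner_eq_zero_of_mem_headSpan hT hn k hxW i hi)
  have hpos : 0 < ‖x‖ ^ 2 := by positivity
  have hchain : c * hT.eigenvalues hn k * ‖x‖ ^ 2 ≤ hS.eigenvalues hn k * ‖x‖ ^ 2 :=
    calc c * hT.eigenvalues hn k * ‖x‖ ^ 2 = c * (hT.eigenvalues hn k * ‖x‖ ^ 2) := by ring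
      _ ≤ c * RCLike.re ⟪T x, x⟫_𝕜 := mul_le_mul_of_nonneg_left hT' hc0
      _ ≤ RCLike.re ⟪S x, x⟫_𝕜 := hc x
      _ ≤ hS.eigenvalues hn k * ‖x‖ ^ 2 := hle
  exact le_of_mul_le_mul_right hchain hpos

/-- **Loewner-type monotonicity, multiplicative upper form.** If `re ⟪S x, x⟫ ≤ c · re ⟪T x, x⟫` for every `x`,
then `λ_k(S) ≤ c · λ_k(T)` for every `k` (test `S` on the span of the bottom `n − k` eigenvectors of `T`, where
`re ⟪T x, x⟫ ≤ λ_k(T) ‖x‖²`). [cite: HornJohnson2013, Thm 4.2.6; Cor 4.3.12] -/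
theorem eigenvalues_le_mul_of_re_inner_le_mul (hT : T.IsSymmetric) (hS : S.IsSymmetric)
    (hn : finrank 𝕜 E = n) {c : ℝ} (hc0 : 0 ≤ c)
    (hc : ∀ x : E, RCLike.re ⟪S x, x⟫_𝕜 ≤ c * RCLike.re ⟪T x, x⟫_𝕜) (k : Fin n) :
    hS.eigenvalues hn k ≤ c * hT.eigenvalues hn k := by
  obtain ⟨x, hxW, hx0, hle⟩ := Literature.Analysis.InnerProduct.exists_mem_eigenvalues_mul_le_re_inner hS hn k
    (Submodule.span 𝕜 (Set.range fun j : {j : Fin n // k ≤ j} => hT.eigenvectorBasis hn j)) (by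
    rw [Literature.Analysis.InnerProduct.finrank_tailSpan hT hn k]; omega)
  have hT' : RCLike.re ⟪T x, x⟫_𝕜 ≤ hT.eigenvalues hn k * ‖x‖ ^ 2 :=
    Literature.Analysis.InnerProduct.re_inner_apply_self_le_of_inner_eq_zero hT hn k
      (fun i hi => Literature.Analysis.InnerProduct.inner_eq_zero_of_mem_tailSpan hT hn k hxW i hi)
  have hpos : 0 < ‖x‖ ^ 2 := by positivity
  have hchain : hS.eigenvalues hn k * ‖x‖ ^ 2 ≤ c * hT.eigenvalues hn k * ‖x‖ ^ 2 :=
    calc hS.eigenvalues hn k * ‖x‖ ^ 2 ≤ RCLike.re ⟪S x, x⟫_𝕜 := hle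
      _ ≤ c * RCLike.re ⟪T x, x⟫_𝕜 := hc x
      _ ≤ c * (hT.eigenvalues hn k * ‖x‖ ^ 2) := mul_le_mul_of_nonneg_left hT' hc0
      _ = c * hT.eigenvalues hn k * ‖x‖ ^ 2 := by ring
  exact le_of_mul_le_mul_right hchain hpos

end Forms

/-! ### §2  Gram matrices: a column-wise relative error bound on the factor gives relative eigenvalue bounds -/

section Gram

variable {m ι : Type*} [Fintype m] [Fintype ι] [DecidableEq ι]

omit [DecidableEq ι] in
/-- The quadratic form of the real Gram matrix `Aᴴ A` (`ᴴ = ᵀ` over `ℝ`) is the squared Euclidean norm of `A y`.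
[folklore] -/
theorem dotProduct_gram_mulVec (A : Matrix m ι ℝ) (y : ι → ℝ) :
    y ⬝ᵥ ((Aᴴ * A) *ᵥ y) = (A *ᵥ y) ⬝ᵥ (A *ᵥ y) := by
  rw [conjTranspose_eq_transpose_of_trivial, ← mulVec_mulVec, dotProduct_mulVec, vecMul_transpose]

/-- Bridge: the real inner product `⟪(toEuclideanLin M) x, x⟫` is the quadratic form `xᵀ M x`. [folklore] -/
theorem inner_toEuclideanLin_self (M : Matrix ι ι ℝ) (x : EuclideanSpace ℝ ι) :
    ⟪Matrix.toEuclideanLin M x, x⟫_ℝ = WithLp.ofLp x ⬝ᵥ (M *ᵥ WithLp.ofLp x) := by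
  rw [real_inner_comm, EuclideanSpace.inner_eq_star_dotProduct, star_trivial, Matrix.ofLp_toLpLin,
    Matrix.toLin'_apply, dotProduct_comm]

omit [DecidableEq ι] in
/-- `‖x‖² = xᵀ x` on `EuclideanSpace ℝ ι`. [folklore] -/
theorem norm_sq_eq_dotProduct (x : EuclideanSpace ℝ ι) : ‖x‖ ^ 2 = WithLp.ofLp x ⬝ᵥ WithLp.ofLp x := by
  rw [EuclideanSpace.real_norm_sq_eq]
  simp only [dotProduct, pow_two]

/-- The quadratic form of `Aᴴ A` as an operator on `EuclideanSpace ℝ ι` is `‖A y‖²`. [folklore] -/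
theorem re_inner_gram_eq_norm_sq (A : Matrix m ι ℝ) (y : EuclideanSpace ℝ ι) :
    RCLike.re ⟪Matrix.toEuclideanLin (Aᴴ * A) y, y⟫_ℝ = ‖Matrix.toEuclideanLin A y‖ ^ 2 := by
  rw [RCLike.re_to_real, inner_toEuclideanLin_self, dotProduct_gram_mulVec, norm_sq_eq_dotProduct,
    Matrix.ofLp_toLpLin, Matrix.toLin'_apply]

variable (X Xt : Matrix m ι ℝ) {η : ℝ}

/-- **Form sandwich, lower half.** If `‖(X̃ − X) y‖ ≤ η ‖X̃ y‖` for all `y`, `η ≤ 1`, then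
`(1 − η)² ‖X̃ y‖² ≤ ‖X y‖²` (reverse triangle inequality; only `η ≤ 1` is used). [folklore] -/
theorem norm_sq_mul_le_of_rel (hη1 : η ≤ 1)
    (hrel : ∀ y : EuclideanSpace ℝ ι, ‖Matrix.toEuclideanLin (Xt - X) y‖ ≤ η * ‖Matrix.toEuclideanLin Xt y‖)
    (y : EuclideanSpace ℝ ι) :
    (1 - η) ^ 2 * ‖Matrix.toEuclideanLin Xt y‖ ^ 2 ≤ ‖Matrix.toEuclideanLin X y‖ ^ 2 := by
  have hsub : Matrix.toEuclideanLin X y = Matrix.toEuclideanLin Xt y - Matrix.toEuclideanLin (Xt - X) y := by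
    rw [map_sub, LinearMap.sub_apply]; abel
  have h1 : (1 - η) * ‖Matrix.toEuclideanLin Xt y‖ ≤ ‖Matrix.toEuclideanLin X y‖ :=
    calc (1 - η) * ‖Matrix.toEuclideanLin Xt y‖
        = ‖Matrix.toEuclideanLin Xt y‖ - η * ‖Matrix.toEuclideanLin Xt y‖ := by ring
      _ ≤ ‖Matrix.toEuclideanLin Xt y‖ - ‖Matrix.toEuclideanLin (Xt - X) y‖ := by linarith [hrel y]
      _ ≤ ‖Matrix.toEuclideanLin Xt y - Matrix.toEuclideanLin (Xt - X) y‖ := norm_sub_norm_le _ _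
      _ = ‖Matrix.toEuclideanLin X y‖ := by rw [← hsub]
  have h0 : 0 ≤ (1 - η) * ‖Matrix.toEuclideanLin Xt y‖ := mul_nonneg (by linarith) (norm_nonneg _)
  calc (1 - η) ^ 2 * ‖Matrix.toEuclideanLin Xt y‖ ^ 2 = ((1 - η) * ‖Matrix.toEuclideanLin Xt y‖) ^ 2 := by ring
    _ ≤ ‖Matrix.toEuclideanLin X y‖ ^ 2 := pow_le_pow_left₀ h0 h1 2

/-- **Form sandwich, upper half.** If `‖(X̃ − X) y‖ ≤ η ‖X̃ y‖` for all `y`, then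
`‖X y‖² ≤ (1 + η)² ‖X̃ y‖²` (triangle inequality). [folklore] -/
theorem norm_sq_le_mul_of_rel
    (hrel : ∀ y : EuclideanSpace ℝ ι, ‖Matrix.toEuclideanLin (Xt - X) y‖ ≤ η * ‖Matrix.toEuclideanLin Xt y‖)
    (y : EuclideanSpace ℝ ι) :
    ‖Matrix.toEuclideanLin X y‖ ^ 2 ≤ (1 + η) ^ 2 * ‖Matrix.toEuclideanLin Xt y‖ ^ 2 := by
  have hsub : Matrix.toEuclideanLin X y = Matrix.toEuclideanLin Xt y - Matrix.toEuclideanLin (Xt - X) y := by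
    rw [map_sub, LinearMap.sub_apply]; abel
  have h1 : ‖Matrix.toEuclideanLin X y‖ ≤ (1 + η) * ‖Matrix.toEuclideanLin Xt y‖ :=
    calc ‖Matrix.toEuclideanLin X y‖ = ‖Matrix.toEuclideanLin Xt y - Matrix.toEuclideanLin (Xt - X) y‖ := by
          rw [← hsub]
      _ ≤ ‖Matrix.toEuclideanLin Xt y‖ + ‖Matrix.toEuclideanLin (Xt - X) y‖ := norm_sub_le _ _
      _ ≤ ‖Matrix.toEuclideanLin Xt y‖ + η * ‖Matrix.toEuclideanLin Xt y‖ := by linarith [hrel y]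
      _ = (1 + η) * ‖Matrix.toEuclideanLin Xt y‖ := by ring
  calc ‖Matrix.toEuclideanLin X y‖ ^ 2 ≤ ((1 + η) * ‖Matrix.toEuclideanLin Xt y‖) ^ 2 :=
        pow_le_pow_left₀ (norm_nonneg _) h1 2
    _ = (1 + η) ^ 2 * ‖Matrix.toEuclideanLin Xt y‖ ^ 2 := by ring

/-- **MULTIPLICATIVE GRAM CERTIFICATE, lower half**: a column-space relative error `‖(X̃ − X) y‖ ≤ η ‖X̃ y‖`
(`η ≤ 1`) gives `(1 − η)² λ↓_k(X̃ᴴX̃) ≤ λ↓_k(XᴴX)` for EVERY index `k`.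
[cite: HornJohnson2013, Thm 4.2.6; Cor 4.3.12] -/
theorem mul_eigenvalues₀_computed_le (hη1 : η ≤ 1)
    (hrel : ∀ y : EuclideanSpace ℝ ι, ‖Matrix.toEuclideanLin (Xt - X) y‖ ≤ η * ‖Matrix.toEuclideanLin Xt y‖)
    (k : Fin (Fintype.card ι)) :
    (1 - η) ^ 2 * (isHermitian_conjTranspose_mul_self Xt).eigenvalues₀ k ≤
      (isHermitian_conjTranspose_mul_self X).eigenvalues₀ k := by
  have hT := Matrix.isSymmetric_toEuclideanLin_iff.mpr (isHermitian_conjTranspose_mul_self Xt)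
  have hS := Matrix.isSymmetric_toEuclideanLin_iff.mpr (isHermitian_conjTranspose_mul_self X)
  have hc : ∀ y : EuclideanSpace ℝ ι, (1 - η) ^ 2 * RCLike.re ⟪Matrix.toEuclideanLin (Xtᴴ * Xt) y, y⟫_ℝ ≤
      RCLike.re ⟪Matrix.toEuclideanLin (Xᴴ * X) y, y⟫_ℝ := by
    intro y
    rw [re_inner_gram_eq_norm_sq, re_inner_gram_eq_norm_sq]
    exact norm_sq_mul_le_of_rel X Xt hη1 hrel y
  exact mul_eigenvalues_le_of_mul_re_inner_le hT hS finrank_euclideanSpace (sq_nonneg _) hc k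

/-- **MULTIPLICATIVE GRAM CERTIFICATE, upper half**: `‖(X̃ − X) y‖ ≤ η ‖X̃ y‖` gives
`λ↓_k(XᴴX) ≤ (1 + η)² λ↓_k(X̃ᴴX̃)` for EVERY index `k`. [cite: HornJohnson2013, Thm 4.2.6; Cor 4.3.12] -/
theorem eigenvalues₀_le_mul_computed
    (hrel : ∀ y : EuclideanSpace ℝ ι, ‖Matrix.toEuclideanLin (Xt - X) y‖ ≤ η * ‖Matrix.toEuclideanLin Xt y‖)
    (k : Fin (Fintype.card ι)) :
    (isHermitian_conjTranspose_mul_self X).eigenvalues₀ k ≤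
      (1 + η) ^ 2 * (isHermitian_conjTranspose_mul_self Xt).eigenvalues₀ k := by
  have hT := Matrix.isSymmetric_toEuclideanLin_iff.mpr (isHermitian_conjTranspose_mul_self Xt)
  have hS := Matrix.isSymmetric_toEuclideanLin_iff.mpr (isHermitian_conjTranspose_mul_self X)
  have hc : ∀ y : EuclideanSpace ℝ ι, RCLike.re ⟪Matrix.toEuclideanLin (Xᴴ * X) y, y⟫_ℝ ≤
      (1 + η) ^ 2 * RCLike.re ⟪Matrix.toEuclideanLin (Xtᴴ * Xt) y, y⟫_ℝ := by
    intro y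
    rw [re_inner_gram_eq_norm_sq, re_inner_gram_eq_norm_sq]
    exact norm_sq_le_mul_of_rel X Xt hrel y
  exact eigenvalues_le_mul_of_re_inner_le_mul hT hS finrank_euclideanSpace (sq_nonneg _) hc k

/-- The two halves together: for every `k`, `λ↓_k(XᴴX) ∈ [(1 − η)² λ↓_k(X̃ᴴX̃), (1 + η)² λ↓_k(X̃ᴴX̃)]` — the
interval every lineage-G row multiplies into its exact enclosure of the computed Gram's eigenvalue.
[cite: HornJohnson2013, Thm 4.2.6; Cor 4.3.12] -/
theorem eigenvalues₀_mem_Icc (hη1 : η ≤ 1)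
    (hrel : ∀ y : EuclideanSpace ℝ ι, ‖Matrix.toEuclideanLin (Xt - X) y‖ ≤ η * ‖Matrix.toEuclideanLin Xt y‖)
    (k : Fin (Fintype.card ι)) :
    (isHermitian_conjTranspose_mul_self X).eigenvalues₀ k ∈
      Set.Icc ((1 - η) ^ 2 * (isHermitian_conjTranspose_mul_self Xt).eigenvalues₀ k)
        ((1 + η) ^ 2 * (isHermitian_conjTranspose_mul_self Xt).eigenvalues₀ k) :=
  ⟨mul_eigenvalues₀_computed_le X Xt hη1 hrel k, eigenvalues₀_le_mul_computed X Xt hrel k⟩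

/-- **The engine's hypothesis implies the column-space bound.** If `‖(X̃ − X) y‖ ≤ e ‖D y‖` and
`s ‖D y‖ ≤ ‖X̃ y‖` for every `y` (the engine: `e ≥ ‖(X̃ − X)D⁻¹‖`, `s ≤ σ_min(X̃ D⁻¹)` for the diagonal
`D = K^{1/2}`; here `D` is any matrix) with `0 < s`, then `‖(X̃ − X) y‖ ≤ (e/s) ‖X̃ y‖`. [folklore] -/
theorem rel_of_abs_and_lower (D : Matrix ι ι ℝ) {e s : ℝ} (he : 0 ≤ e) (hs : 0 < s)
    (hE : ∀ y : EuclideanSpace ℝ ι, ‖Matrix.toEuclideanLin (Xt - X) y‖ ≤ e * ‖Matrix.toEuclideanLin D y‖)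
    (hS : ∀ y : EuclideanSpace ℝ ι, s * ‖Matrix.toEuclideanLin D y‖ ≤ ‖Matrix.toEuclideanLin Xt y‖)
    (y : EuclideanSpace ℝ ι) :
    ‖Matrix.toEuclideanLin (Xt - X) y‖ ≤ (e / s) * ‖Matrix.toEuclideanLin Xt y‖ := by
  have hD : ‖Matrix.toEuclideanLin D y‖ ≤ ‖Matrix.toEuclideanLin Xt y‖ / s := by
    rw [le_div_iff₀ hs, mul_comm]; exact hS y
  calc ‖Matrix.toEuclideanLin (Xt - X) y‖ ≤ e * ‖Matrix.toEuclideanLin D y‖ := hE y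
    _ ≤ e * (‖Matrix.toEuclideanLin Xt y‖ / s) := mul_le_mul_of_nonneg_left hD he
    _ = (e / s) * ‖Matrix.toEuclideanLin Xt y‖ := by ring

end Gram

end MultiplicativeGram

end Summit.Ventures.YMGap.FlowData

namespace Summit.Ventures.YMGap.FlowData

namespace MultiplicativeGram

/-! ### §3  Where `s` comes from: composition of the factor, and the a-priori floor from a coercive Gram form -/

section Floor

variable {m ι : Type*} [Fintype m] [Fintype ι] [DecidableEq ι]

omit [Fintype m] in
/-- `(F D) y = F (D y)` as maps on Euclidean space. [folklore] -/
theorem toEuclideanLin_mul_apply (F : Matrix m ι ℝ) (D : Matrix ι ι ℝ) (y : EuclideanSpace ℝ ι) :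
    Matrix.toEuclideanLin (F * D) y = Matrix.toEuclideanLin F (Matrix.toEuclideanLin D y) := by
  apply (WithLp.ofLp_injective (p := 2))
  simp [Matrix.ofLp_toLpLin, Matrix.mulVec_mulVec]

/-- **A-priori floor for `s`.** If the Gram form of `F` dominates `μ ‖u‖²` (for lineage G: `FᴴF = P_S`, the
kept-set compression of the multiplication operator by the positive plaquette weight `∏_p e^{β(½Tr U_p − 1)} ≥ e^{−2βN}`
on the gauge-invariant space, so `μ = e^{−2βN}` works), then the graded factor `X̃ := F D` satisfies
`μ ‖D y‖² ≤ ‖X̃ y‖²` for every `y` and ANY grading `D` — i.e. `s ≥ √μ` whatever the link-kernel weights.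
[folklore] -/
theorem mul_norm_sq_le_norm_sq_mul (F : Matrix m ι ℝ) (D : Matrix ι ι ℝ) {μ : ℝ}
    (hμ : ∀ u : EuclideanSpace ℝ ι, μ * ‖u‖ ^ 2 ≤ ‖Matrix.toEuclideanLin F u‖ ^ 2) (y : EuclideanSpace ℝ ι) :
    μ * ‖Matrix.toEuclideanLin D y‖ ^ 2 ≤ ‖Matrix.toEuclideanLin (F * D) y‖ ^ 2 := by
  rw [toEuclideanLin_mul_apply]
  exact hμ _

/-- The two engine inputs in norm form: from `μ ‖D y‖² ≤ ‖X̃ y‖²` (`0 < μ`) get `√μ ‖D y‖ ≤ ‖X̃ y‖`, the shape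
used by `rel_of_abs_and_lower`. [folklore] -/
theorem sqrt_mul_norm_le (Xt D : Matrix m ι ℝ) {μ : ℝ} (hμ0 : 0 ≤ μ)
    (h : ∀ y : EuclideanSpace ℝ ι, μ * ‖Matrix.toEuclideanLin D y‖ ^ 2 ≤ ‖Matrix.toEuclideanLin Xt y‖ ^ 2)
    (y : EuclideanSpace ℝ ι) :
    Real.sqrt μ * ‖Matrix.toEuclideanLin D y‖ ≤ ‖Matrix.toEuclideanLin Xt y‖ := by
  have h1 : (Real.sqrt μ * ‖Matrix.toEuclideanLin D y‖) ^ 2 ≤ ‖Matrix.toEuclideanLin Xt y‖ ^ 2 := by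
    rw [mul_pow, Real.sq_sqrt hμ0]; exact h y
  exact (sq_le_sq₀ (mul_nonneg (Real.sqrt_nonneg _) (norm_nonneg _)) (norm_nonneg _)).mp h1

end Floor

end MultiplicativeGram

end Summit.Ventures.YMGap.FlowData

namespace Summit.Ventures.YMGap.FlowData

namespace MultiplicativeGram

/-! ### §4  The SPLIT variant: a relative error on part of the columns and an absolute error on the rest

If `‖(X̃ − X) y‖ ≤ η ‖X̃ y‖ + a ‖y‖` for every `y` (lineage G: the well-resolved columns are charged relatively through
`η = e_B/s`, the tiny-weight columns absolutely through `a = a_T`), then with any `σ` bracketing the computed level,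
`σ² ≤ λ↓_k(X̃ᴴX̃)` resp. `λ↓_k(X̃ᴴX̃) ≤ σ²`, one gets `((1 − η)σ − a)² ≤ λ↓_k(XᴴX)` resp.
`λ↓_k(XᴴX) ≤ ((1 + η)σ + a)²` — Courant–Fischer on the functional `y ↦ ‖X y‖ / ‖y‖` with the head / tail eigen-spans
of `X̃ᴴX̃` as trial subspaces (Horn–Johnson Thm. 4.2.6 / Thm. 7.3.8 for singular values). -/

section Split

variable {m ι : Type*} [Fintype m] [Fintype ι] [DecidableEq ι]

variable (X Xt : Matrix m ι ℝ) {η a σ : ℝ} {k : Fin (Fintype.card ι)}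

/-- On the span of the top `k + 1` eigenvectors of `X̃ᴴX̃`, `‖X̃ y‖ ≥ σ ‖y‖` whenever `σ² ≤ λ↓_k(X̃ᴴX̃)`, `0 ≤ σ`.
[cite: HornJohnson2013, Thm 4.2.6] -/
theorem mul_norm_le_norm_of_mem_headSpan (hσ0 : 0 ≤ σ)
    (hσ : σ ^ 2 ≤ (isHermitian_conjTranspose_mul_self Xt).eigenvalues₀ k) {y : EuclideanSpace ℝ ι}
    (hy : y ∈ Submodule.span ℝ (Set.range fun j : {j : Fin (Fintype.card ι) // j ≤ k} =>
      (Matrix.isSymmetric_toEuclideanLin_iff.mpr (isHermitian_conjTranspose_mul_self Xt)).eigenvectorBasis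
        finrank_euclideanSpace j)) :
    σ * ‖y‖ ≤ ‖Matrix.toEuclideanLin Xt y‖ := by
  have hT := Matrix.isSymmetric_toEuclideanLin_iff.mpr (isHermitian_conjTranspose_mul_self Xt)
  have h1 : hT.eigenvalues finrank_euclideanSpace k * ‖y‖ ^ 2 ≤
      RCLike.re ⟪Matrix.toEuclideanLin (Xtᴴ * Xt) y, y⟫_ℝ :=
    Literature.Analysis.InnerProduct.le_re_inner_apply_self_of_inner_eq_zero hT finrank_euclideanSpace k
      (fun i hi => Literature.Analysis.InnerProduct.inner_eq_zero_of_mem_headSpan hT finrank_euclideanSpace k hy i hi)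
  rw [re_inner_gram_eq_norm_sq] at h1
  have h2 : (σ * ‖y‖) ^ 2 ≤ ‖Matrix.toEuclideanLin Xt y‖ ^ 2 :=
    calc (σ * ‖y‖) ^ 2 = σ ^ 2 * ‖y‖ ^ 2 := by ring
      _ ≤ hT.eigenvalues finrank_euclideanSpace k * ‖y‖ ^ 2 := mul_le_mul_of_nonneg_right hσ (sq_nonneg _)
      _ ≤ ‖Matrix.toEuclideanLin Xt y‖ ^ 2 := h1
  exact (sq_le_sq₀ (mul_nonneg hσ0 (norm_nonneg _)) (norm_nonneg _)).mp h2

/-- On the span of the bottom `n − k` eigenvectors of `X̃ᴴX̃`, `‖X̃ y‖ ≤ σ ‖y‖` whenever `λ↓_k(X̃ᴴX̃) ≤ σ²`, `0 ≤ σ`.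
[cite: HornJohnson2013, Thm 4.2.6] -/
theorem norm_le_mul_norm_of_mem_tailSpan (hσ0 : 0 ≤ σ)
    (hσ : (isHermitian_conjTranspose_mul_self Xt).eigenvalues₀ k ≤ σ ^ 2) {y : EuclideanSpace ℝ ι}
    (hy : y ∈ Submodule.span ℝ (Set.range fun j : {j : Fin (Fintype.card ι) // k ≤ j} =>
      (Matrix.isSymmetric_toEuclideanLin_iff.mpr (isHermitian_conjTranspose_mul_self Xt)).eigenvectorBasis
        finrank_euclideanSpace j)) :
    ‖Matrix.toEuclideanLin Xt y‖ ≤ σ * ‖y‖ := by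
  have hT := Matrix.isSymmetric_toEuclideanLin_iff.mpr (isHermitian_conjTranspose_mul_self Xt)
  have h1 : RCLike.re ⟪Matrix.toEuclideanLin (Xtᴴ * Xt) y, y⟫_ℝ ≤
      hT.eigenvalues finrank_euclideanSpace k * ‖y‖ ^ 2 :=
    Literature.Analysis.InnerProduct.re_inner_apply_self_le_of_inner_eq_zero hT finrank_euclideanSpace k
      (fun i hi => Literature.Analysis.InnerProduct.inner_eq_zero_of_mem_tailSpan hT finrank_euclideanSpace k hy i hi)
  rw [re_inner_gram_eq_norm_sq] at h1
  have h2 : ‖Matrix.toEuclideanLin Xt y‖ ^ 2 ≤ (σ * ‖y‖) ^ 2 :=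
    calc ‖Matrix.toEuclideanLin Xt y‖ ^ 2 ≤ hT.eigenvalues finrank_euclideanSpace k * ‖y‖ ^ 2 := h1
      _ ≤ σ ^ 2 * ‖y‖ ^ 2 := mul_le_mul_of_nonneg_right hσ (sq_nonneg _)
      _ = (σ * ‖y‖) ^ 2 := by ring
  exact (sq_le_sq₀ (norm_nonneg _) (mul_nonneg hσ0 (norm_nonneg _))).mp h2

/-- **SPLIT CERTIFICATE, lower half.** `‖(X̃ − X) y‖ ≤ η ‖X̃ y‖ + a ‖y‖` for all `y`, `η ≤ 1`, and a level bracket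
`σ² ≤ λ↓_k(X̃ᴴX̃)` (`0 ≤ σ`) with `0 ≤ (1 − η)σ − a` give `((1 − η)σ − a)² ≤ λ↓_k(XᴴX)`.
[cite: HornJohnson2013, Thm 4.2.6] -/
theorem sq_le_eigenvalues₀_of_split (hη1 : η ≤ 1) (hσ0 : 0 ≤ σ) (hpos : 0 ≤ (1 - η) * σ - a)
    (hσ : σ ^ 2 ≤ (isHermitian_conjTranspose_mul_self Xt).eigenvalues₀ k)
    (hrel : ∀ y : EuclideanSpace ℝ ι,
      ‖Matrix.toEuclideanLin (Xt - X) y‖ ≤ η * ‖Matrix.toEuclideanLin Xt y‖ + a * ‖y‖)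
    : ((1 - η) * σ - a) ^ 2 ≤ (isHermitian_conjTranspose_mul_self X).eigenvalues₀ k := by
  have hT := Matrix.isSymmetric_toEuclideanLin_iff.mpr (isHermitian_conjTranspose_mul_self Xt)
  have hS := Matrix.isSymmetric_toEuclideanLin_iff.mpr (isHermitian_conjTranspose_mul_self X)
  obtain ⟨y, hyW, hy0, hle⟩ := Literature.Analysis.InnerProduct.exists_mem_re_inner_le_eigenvalues_mul hS
    finrank_euclideanSpace k
    (Submodule.span ℝ (Set.range fun j : {j : Fin (Fintype.card ι) // j ≤ k} =>
      hT.eigenvectorBasis finrank_euclideanSpace j)) (by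
    rw [Literature.Analysis.InnerProduct.finrank_headSpan hT finrank_euclideanSpace k])
  rw [re_inner_gram_eq_norm_sq] at hle
  have hsub : Matrix.toEuclideanLin X y = Matrix.toEuclideanLin Xt y - Matrix.toEuclideanLin (Xt - X) y := by
    rw [map_sub, LinearMap.sub_apply]; abel
  have hXt : σ * ‖y‖ ≤ ‖Matrix.toEuclideanLin Xt y‖ := mul_norm_le_norm_of_mem_headSpan Xt hσ0 hσ hyW
  have h1 : ((1 - η) * σ - a) * ‖y‖ ≤ ‖Matrix.toEuclideanLin X y‖ :=
    calc ((1 - η) * σ - a) * ‖y‖ = (1 - η) * (σ * ‖y‖) - a * ‖y‖ := by ring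
      _ ≤ (1 - η) * ‖Matrix.toEuclideanLin Xt y‖ - a * ‖y‖ := by
          have := mul_le_mul_of_nonneg_left hXt (show (0:ℝ) ≤ 1 - η by linarith); linarith
      _ = ‖Matrix.toEuclideanLin Xt y‖ - (η * ‖Matrix.toEuclideanLin Xt y‖ + a * ‖y‖) := by ring
      _ ≤ ‖Matrix.toEuclideanLin Xt y‖ - ‖Matrix.toEuclideanLin (Xt - X) y‖ := by linarith [hrel y]
      _ ≤ ‖Matrix.toEuclideanLin Xt y - Matrix.toEuclideanLin (Xt - X) y‖ := norm_sub_norm_le _ _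
      _ = ‖Matrix.toEuclideanLin X y‖ := by rw [← hsub]
  have hpos' : 0 ≤ ((1 - η) * σ - a) * ‖y‖ := mul_nonneg hpos (norm_nonneg _)
  have h2 : ((1 - η) * σ - a) ^ 2 * ‖y‖ ^ 2 ≤ ‖Matrix.toEuclideanLin X y‖ ^ 2 :=
    calc ((1 - η) * σ - a) ^ 2 * ‖y‖ ^ 2 = (((1 - η) * σ - a) * ‖y‖) ^ 2 := by ring
      _ ≤ ‖Matrix.toEuclideanLin X y‖ ^ 2 := pow_le_pow_left₀ hpos' h1 2
  have hposn : 0 < ‖y‖ ^ 2 := by positivity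
  exact le_of_mul_le_mul_right (h2.trans hle) hposn

/-- **SPLIT CERTIFICATE, upper half.** `‖(X̃ − X) y‖ ≤ η ‖X̃ y‖ + a ‖y‖` for all `y` (`0 ≤ η`) and a level
bracket `λ↓_k(X̃ᴴX̃) ≤ σ²` (`0 ≤ σ`) give `λ↓_k(XᴴX) ≤ ((1 + η)σ + a)²` (no sign needed on `a`: the hypothesis forces
`0 ≤ η‖X̃y‖ + a‖y‖`). [cite: HornJohnson2013, Thm 4.2.6] -/
theorem eigenvalues₀_le_sq_of_split (hη0 : 0 ≤ η) (hσ0 : 0 ≤ σ)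
    (hσ : (isHermitian_conjTranspose_mul_self Xt).eigenvalues₀ k ≤ σ ^ 2)
    (hrel : ∀ y : EuclideanSpace ℝ ι,
      ‖Matrix.toEuclideanLin (Xt - X) y‖ ≤ η * ‖Matrix.toEuclideanLin Xt y‖ + a * ‖y‖)
    : (isHermitian_conjTranspose_mul_self X).eigenvalues₀ k ≤ ((1 + η) * σ + a) ^ 2 := by
  have hT := Matrix.isSymmetric_toEuclideanLin_iff.mpr (isHermitian_conjTranspose_mul_self Xt)
  have hS := Matrix.isSymmetric_toEuclideanLin_iff.mpr (isHermitian_conjTranspose_mul_self X)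
  obtain ⟨y, hyW, hy0, hle⟩ := Literature.Analysis.InnerProduct.exists_mem_eigenvalues_mul_le_re_inner hS
    finrank_euclideanSpace k
    (Submodule.span ℝ (Set.range fun j : {j : Fin (Fintype.card ι) // k ≤ j} =>
      hT.eigenvectorBasis finrank_euclideanSpace j)) (by
    rw [Literature.Analysis.InnerProduct.finrank_tailSpan hT finrank_euclideanSpace k]; omega)
  rw [re_inner_gram_eq_norm_sq] at hle
  have hsub : Matrix.toEuclideanLin X y = Matrix.toEuclideanLin Xt y - Matrix.toEuclideanLin (Xt - X) y := by
    rw [map_sub, LinearMap.sub_apply]; abel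
  have hXt : ‖Matrix.toEuclideanLin Xt y‖ ≤ σ * ‖y‖ := norm_le_mul_norm_of_mem_tailSpan Xt hσ0 hσ hyW
  have h1 : ‖Matrix.toEuclideanLin X y‖ ≤ ((1 + η) * σ + a) * ‖y‖ :=
    calc ‖Matrix.toEuclideanLin X y‖ = ‖Matrix.toEuclideanLin Xt y - Matrix.toEuclideanLin (Xt - X) y‖ := by
          rw [← hsub]
      _ ≤ ‖Matrix.toEuclideanLin Xt y‖ + ‖Matrix.toEuclideanLin (Xt - X) y‖ := norm_sub_le _ _
      _ ≤ ‖Matrix.toEuclideanLin Xt y‖ + (η * ‖Matrix.toEuclideanLin Xt y‖ + a * ‖y‖) := by linarith [hrel y]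
      _ = (1 + η) * ‖Matrix.toEuclideanLin Xt y‖ + a * ‖y‖ := by ring
      _ ≤ (1 + η) * (σ * ‖y‖) + a * ‖y‖ := by
          have := mul_le_mul_of_nonneg_left hXt (show (0:ℝ) ≤ 1 + η by linarith); linarith
      _ = ((1 + η) * σ + a) * ‖y‖ := by ring
  have h2 : ‖Matrix.toEuclideanLin X y‖ ^ 2 ≤ ((1 + η) * σ + a) ^ 2 * ‖y‖ ^ 2 :=
    calc ‖Matrix.toEuclideanLin X y‖ ^ 2 ≤ (((1 + η) * σ + a) * ‖y‖) ^ 2 := pow_le_pow_left₀ (norm_nonneg _) h1 2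
      _ = ((1 + η) * σ + a) ^ 2 * ‖y‖ ^ 2 := by ring
  have hposn : 0 < ‖y‖ ^ 2 := by positivity
  exact le_of_mul_le_mul_right (hle.trans h2) hposn

end Split

end MultiplicativeGram

end Summit.Ventures.YMGap.FlowData
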